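import Summits.BirchSwinnertonDyer.BirchSwinnertonDyer.Theorems.SlopeDichotomyA2DegenerateLocusA2HeightIntegralityIsogeny
import Literature.NumberTheory.EllipticCurves.CanonicalPAdicHeightIntegralityBoundedIndexProofs
import HarnessLib

/-!
# Height integrality read on the IMAGE curve: `ord_p Reg_p(E) ≥ −2c'` from the Tamagawa indices of `E' = E/Φ`
# (Mazur–Tate's bounded-exponent value subgroup on `E'` + the isogeny adjunction), with NO structural
# hypothesis on the isogeny — and T-λ3 on 34 of the 42 residual A2 class-pairs

Support file (prover seat `bsd-schneider-i1-c2`, gen 7, cell `bsd-schneider-ideate`; `--supports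
stmt-BirchSwinnertonDyer-19086`), companion of `…RegulatorFloorBoundedIndex.lean` (road 3: the lcm floor on `E`
itself, 800 pairs) in the height-integrality series (`…HeightIntegrality` p460291 / `…Isogeny` p461719 / `…Neron`
p464779: road 1, isogeny descent with the index hypothesis ON `E` and the structural hypotheses (red), (comp)).

ROAD 4 (this file). Gen 6 put the index hypothesis on `E = E₁` (the member carrying the unramified line `Φ`) and
dismissed the version with the hypothesis on the image `E' = E₁/Φ` as «near-vacuous» (it holds on 716 census pairs
against 1 765) — but the two loci are DISJOINT (kit j257621: `p ∤ ∏c_ℓ(E₁)` on 1 765, `p ∤ ∏c_ℓ(E₁/Φ)` on 716,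
never both: across `Φ` a split multiplicative `c_ℓ` is multiplied or divided by `p` according as `Φ` is `μ_p` or
étale at `ℓ`, Dokchitser–Dokchitser 2015 Thm. 23), so the image version is exactly what the residue needs. And it
needs NO structural input: for `Q ∈ E(ℚ)`, `⟨fQ, fQ⟩' = p·⟨Q, Q⟩` (Mazur–Tate 1983 (3.4.3) + `φ̂ ∘ φ = [p]`,
`…Isogeny.pairing_pointHom_pointHom_of_adjoint`), and `‖⟨fQ, fQ⟩'‖ ≤ p^{2c'−1}` is the Literature bounded-exponent
floor ON `E'` (`norm_pairing_self_le_of_index_le`, p475274: `ord_p #Ẽ'(𝔽_p) ≤ c'`, `p^{c'+1} ∤ [E'(ℚ) : E'(ℚ) ∩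
E'⁰(ℚ_ℓ)]` for all `ℓ`) applied to the point `fQ` — whence `‖⟨Q, Q⟩‖ ≤ p^{2c'}`, `ord_p Reg_p(E) ≥ −2c'·rank`
(§1). Neither (red) nor (comp) is used: once `c' ≥ 1` the anomalous factor `p` of `N_p(E')` costs nothing extra
in the least common multiple (for `c' = 0` road 1's (red) is what saves the factor).

On corner A2 (§2–§3): `E'` is again a leaf curve (`RankOne.Leaf.of_isIsogenous`), `ord_p N_p(E') = 1 ≤ c'`, and
the floor `ord Reg + ord Tam ≥ 0` holds as soon as `2c' ≤ ord_p ∏c_ℓ(E)` — T-λ3 follows by `…RegulatorFloorPub`.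
CENSUS (g6's kit j258343 + j257621 re-tabulated): of the 42 A2 class-pairs with a Tamagawa index of `E₁` divisible
by `p²` (all with `ord_p ∏c_ℓ(E₁) ≥ 2`), **34 have every `c_ℓ(E₁/Φ)` at most once divisible by `p`** (`c' = 1`,
`2c' = 2 ≤ ord_p ∏c_ℓ(E₁)`: this file), 3 are already covered by road 3 with `c = 2`, and 5 remain
(11858z1, 225302bd1, 229658c1, 245630t1, 443450cz1 @3: `c₂(E₁) ∈ {9, 18}` with the generator of order `9 | 18` in
the component group and `c₂(E₁/Φ) ∈ {27, 54}` — `Φ` is `μ₃` at `ℓ = 2`): the residue of T-λ3 on the census after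
roads 1–4 is these 5 pairs, which only genuine local heights off `E⁰` (denominator `c_ℓ`, not `k_ℓ²`) can reach.

* §1 `norm_pairing_le_of_isogeny_of_image_index_le` (`‖⟨P, Q⟩‖ ≤ p^{2c'}`),
  `valuation_padicRegulator_ge_of_isogeny_of_image_index_le` (`Reg_p ≠ 0 ⇒ −2c'·rank ≤ ord_p Reg_p`).
* §2 `regTamFloor_of_typeBRankOne_of_isogeny_of_image_index_le` (A2 floor from `2c' ≤ ord_p ∏c_ℓ(E)`).
* §3 **`not_analyticLambdaEq_one_of_typeBRankOne_of_isogeny_of_image_index_le`** (T-λ3: `λ_an ≠ 1`),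
  `three_le_…` (`λ_an ≥ 3`) — published inputs BY NAME (W16, BMS 1.7, GV 1.3, Greenberg 5.10, Mazur–Tate σ,
  modularity, GZK, MT83 (3.4.3)) + the degree-`p` `ℚ`-isogeny + two per-pair DECIDABLE data
  (`p^{c'+1} ∤` indices of `E'`, `2c' ≤ ord_p ∏c_ℓ(E)`); NO height value inspected; NO (red)/(comp).

HONEST NOTE. Item 19086 is untouched (DECIDED-REDUCED, gens 0–6; refutation budget re-read gen 7); BSD is not
advanced; every theorem is conditional on the named facts.

References: [MazurTate1983Biext] §3.3, §3.4 (3.4.3), (4.1.1); [MazurSteinTate2006] Alg. 3.4 step 1;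
[DokchitserDokchitser2015LocalInvariants] Thm. 23; [BalakrishnanMullerStein2015] Thm. 1.7; [GreenbergVatsal2000]
Thm. (1.3); [GreenbergLNM1716] Prop. 5.10; [Wuthrich2014] Thm. 16; memo ROUTE-P3-v8-lambda-g10 §1.3;
FINDING-i1-c2-g6 §2–2b; FINDING-i1-c2-g7.
-/

set_option autoImplicit false

noncomputable section

open scoped Classical MatrixGroups ModularForm

open PowerSeries CongruenceSubgroup WeierstrassCurve Literature.NumberTheory.EllipticCurves
  Literature.NumberTheory.EllipticCurves.ModularForms Literature.NumberTheory.EllipticCurves.Rank1Residual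
  Literature.NumberTheory.EllipticCurves.Greenberg1999 Summit.BirchSwinnertonDyer.Rank1Residual
  Summit.BirchSwinnertonDyer.BirchSwinnertonDyer.Theorems.Rank1ResidualX1Defs
  Summit.BirchSwinnertonDyer.Rank1Residual.X1.MuLambda Summit.BirchSwinnertonDyer.Rank1Residual.X1.MuPart
  Summit.BirchSwinnertonDyer.Rank1Residual.X1.ParitySqueeze Summit.BirchSwinnertonDyer.BirchSwinnertonDyer.Theses
  Summit.BirchSwinnertonDyer.BirchSwinnertonDyer.Theorems
  Summit.BirchSwinnertonDyer.BirchSwinnertonDyer.Theorems.DegenerateLocusA2HeightIntegralityIsogeny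

set_option linter.dupNamespace false -- summit = sub-problem name (D-0017 layout)

namespace Summit.BirchSwinnertonDyer.BirchSwinnertonDyer.Theorems.DegenerateLocusA2HeightIntegralityImage

variable {W W' : WeierstrassCurve ℚ} [W.IsElliptic] [W.IsGloballyMinimal] [W'.IsElliptic] [W'.IsGloballyMinimal]
  {p : ℕ} [Fact p.Prime]

/-! ## §1. The floor on `E` from the bounded-exponent value subgroup on `E'` and the adjunction -/

/-- **`‖⟨Q, Q⟩_E‖ ≤ p^{2c'}` from the indices of the image curve.** Let `E, E'/ℚ` be globally minimal, `p ≥ 3`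
good ordinary for both, `ord_p #Ẽ'(𝔽_p) ≤ c'`, `p^{c'+1} ∤ [E'(ℚ) : E'(ℚ) ∩ E'⁰(ℚ_ℓ)]` for every `ℓ`, and
`φ : E → E'` a `ℚ`-isogeny of degree `p` with map `f` on rational points. Then for THE canonical datum `D` of `E`
and every `Q ∈ E(ℚ)`: `p·⟨Q,Q⟩ = ⟨fQ,fQ⟩'` (MT83 (3.4.3), `hadjF`) has norm `≤ p^{2c'−1}` (Mazur–Tate §3.3 on
`E'`, PROVED `norm_pairing_self_le_of_index_le`), so `‖⟨Q, Q⟩‖ ≤ p^{2c'}`. No hypothesis on `φ` beyond its degree.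
[cite: MazurTate1983Biext, §3.3 (display after (3.3.4)), §3.4 (3.4.3), (4.1.1)]
[cite: MazurSteinTate2006, Alg. 3.4 step 1] -/
theorem norm_pairing_self_le_of_isogeny_of_image_index_le
    (hadjF : Literature.NumberTheory.EllipticCurves.canonicalPAdicHeight_isogeny_adjoint)
    (hMT : mazur_tate_sigma_exists_odd) (hp : 3 ≤ p)
    (hgood : W.HasGoodReductionAtPrime p) (hord : ¬ (p : ℤ) ∣ W.frobeniusTrace p)
    (hgood' : W'.HasGoodReductionAtPrime p) (hord' : ¬ (p : ℤ) ∣ W'.frobeniusTrace p) {c' : ℕ}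
    (hN' : padicValNat p (W'.reductionPointCount p) ≤ c')
    (hidx' : ∀ (ℓ : ℕ) [Fact ℓ.Prime], ¬ p ^ (c' + 1) ∣ (W'.nonsingularReductionSubgroupAt ℓ).index)
    (φ : Isogeny W W') (hdeg : φ.degree = p) {f : W.toAffine.Point →+ W'.toAffine.Point}
    (hf : ∀ P : W.toAffine.Point, W'.toGeomPoints (f P) = φ (W.toGeomPoints P))
    {D : PAdicHeightData W p} (hD : D.IsCanonical) (Q : W.toAffine.Point) :
    ‖D.pairing Q Q‖ ≤ (p : ℝ) ^ (2 * (c' : ℤ)) := by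
  have hpp : p.Prime := Fact.out
  have hp2 : p ≠ 2 := by omega
  have hp0 : (0 : ℝ) < p := by exact_mod_cast hpp.pos
  obtain ⟨D', hD'⟩ := exists_isCanonical_of_odd hMT W' p hp2 hgood' hord'
  have hadj : D'.pairing (f Q) (f Q) = (p : ℚ_[p]) * D.pairing Q Q := by
    rw [pairing_pointHom_pointHom_of_adjoint hadjF hp2 hgood hord hgood' hord' φ hf hD hD', hdeg]
  have key := norm_pairing_self_le_of_index_le W' p hp hgood' hN' hidx' hD' (f Q)
  rw [hadj, norm_mul, Padic.norm_p] at key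
  -- `p⁻¹ · ‖⟨Q,Q⟩‖ ≤ p^{2c'-1}` ⇒ `‖⟨Q,Q⟩‖ ≤ p^{2c'}`
  have hinv : (0 : ℝ) < (p : ℝ)⁻¹ := by positivity
  have h1 : ‖D.pairing Q Q‖ ≤ (p : ℝ) ^ (2 * (c' : ℤ) - 1) / (p : ℝ)⁻¹ := by
    rw [le_div_iff₀ hinv, mul_comm]; exact key
  refine h1.trans (le_of_eq ?_)
  rw [div_eq_mul_inv, inv_inv, ← zpow_add_one₀ hp0.ne']
  congr 1
  ring

/-- **`‖⟨P, Q⟩_E‖ ≤ p^{2c'}` for all `P, Q`** (polarisation, `‖2‖_p = 1` for odd `p`).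
[cite: MazurTate1983Biext, §3.3, §3.4 (3.4.3), (4.1.1)–(4.1.2)] -/
theorem norm_pairing_le_of_isogeny_of_image_index_le
    (hadjF : Literature.NumberTheory.EllipticCurves.canonicalPAdicHeight_isogeny_adjoint)
    (hMT : mazur_tate_sigma_exists_odd) (hp : 3 ≤ p)
    (hgood : W.HasGoodReductionAtPrime p) (hord : ¬ (p : ℤ) ∣ W.frobeniusTrace p)
    (hgood' : W'.HasGoodReductionAtPrime p) (hord' : ¬ (p : ℤ) ∣ W'.frobeniusTrace p) {c' : ℕ}
    (hN' : padicValNat p (W'.reductionPointCount p) ≤ c')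
    (hidx' : ∀ (ℓ : ℕ) [Fact ℓ.Prime], ¬ p ^ (c' + 1) ∣ (W'.nonsingularReductionSubgroupAt ℓ).index)
    (φ : Isogeny W W') (hdeg : φ.degree = p) {f : W.toAffine.Point →+ W'.toAffine.Point}
    (hf : ∀ P : W.toAffine.Point, W'.toGeomPoints (f P) = φ (W.toGeomPoints P))
    {D : PAdicHeightData W p} (hD : D.IsCanonical) (P Q : W.toAffine.Point) :
    ‖D.pairing P Q‖ ≤ (p : ℝ) ^ (2 * (c' : ℤ)) := by
  have hpp : p.Prime := Fact.out
  have hp2 : p ≠ 2 := by omega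
  set b : ℝ := (p : ℝ) ^ (2 * (c' : ℤ)) with hb
  have hdiag : ∀ R : W.toAffine.Point, ‖D.pairing R R‖ ≤ b := fun R ↦
    norm_pairing_self_le_of_isogeny_of_image_index_le hadjF hMT hp hgood hord hgood' hord' hN' hidx' φ hdeg
      hf hD R
  have hpol : (2 : ℚ_[p]) * D.pairing P Q =
      D.pairing (P + Q) (P + Q) - D.pairing P P - D.pairing Q Q := by
    simp only [map_add, AddMonoidHom.add_apply, D.symm Q P]; ring
  have hsub : ∀ a b : ℚ_[p], ‖a - b‖ ≤ max ‖a‖ ‖b‖ := fun a b ↦ by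
    rw [sub_eq_add_neg, ← norm_neg b]; exact IsUltrametricDist.norm_add_le_max a (-b)
  have h2 : ‖(2 : ℚ_[p])‖ = 1 := by
    have : ((2 : ℕ) : ℚ_[p]) = 2 := by norm_num
    rw [← this, Padic.norm_natCast_eq_one_iff]
    exact (Nat.coprime_primes hpp Nat.prime_two).mpr hp2
  have key : ‖(2 : ℚ_[p]) * D.pairing P Q‖ ≤ b := by
    rw [hpol]
    refine (hsub _ _).trans (max_le ?_ (hdiag Q))
    exact (hsub _ _).trans (max_le (hdiag _) (hdiag P))
  rwa [norm_mul, h2, one_mul] at key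

/-- **`Reg_p(E) ≠ 0 ⇒ −2c'·rank ≤ ord_p Reg_p(E)`** from the indices of the image curve `E'` of a degree-`p`
`ℚ`-isogeny (ultrametric Hadamard on a Mordell–Weil basis; same hypotheses). Modulo MT83 (3.4.3) and Mazur–Tate σ
at odd `p` only. [cite: MazurTate1983Biext, §3.3, §3.4 (3.4.3), (4.1.1)]
[cite: KunduRay2024, §3 (display before Thm 3.6)] -/
theorem valuation_padicRegulator_ge_of_isogeny_of_image_index_le
    (hadjF : Literature.NumberTheory.EllipticCurves.canonicalPAdicHeight_isogeny_adjoint)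
    (hMT : mazur_tate_sigma_exists_odd) (hp : 3 ≤ p)
    (hgood : W.HasGoodReductionAtPrime p) (hord : ¬ (p : ℤ) ∣ W.frobeniusTrace p)
    (hgood' : W'.HasGoodReductionAtPrime p) (hord' : ¬ (p : ℤ) ∣ W'.frobeniusTrace p) {c' : ℕ}
    (hN' : padicValNat p (W'.reductionPointCount p) ≤ c')
    (hidx' : ∀ (ℓ : ℕ) [Fact ℓ.Prime], ¬ p ^ (c' + 1) ∣ (W'.nonsingularReductionSubgroupAt ℓ).index)
    (φ : Isogeny W W') (hdeg : φ.degree = p) {f : W.toAffine.Point →+ W'.toAffine.Point}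
    (hf : ∀ P : W.toAffine.Point, W'.toGeomPoints (f P) = φ (W.toGeomPoints P))
    {D : PAdicHeightData W p} (hD : D.IsCanonical) (hR : padicRegulator D ≠ 0) :
    -(2 * (c' : ℤ)) * W.mordellWeilRank ≤ (padicRegulator D).valuation := by
  have hpp : p.Prime := Fact.out
  have hp1 : (1 : ℝ) < p := by exact_mod_cast hpp.one_lt
  have h := norm_padicRegulator_le_pow_of_forall_norm_pairing_le W p (by positivity)
    (norm_pairing_le_of_isogeny_of_image_index_le hadjF hMT hp hgood hord hgood' hord' hN' hidx' φ hdeg hf hD)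
  rw [Padic.norm_eq_zpow_neg_valuation hR, ← zpow_natCast, ← zpow_mul] at h
  have h' := (zpow_le_zpow_iff_right₀ hp1).mp h
  linarith

/-! ## §2. Corner A2: the regulator–Tamagawa floor from the image curve's indices -/

/-- **On corner A2, the floor `Reg_p ≠ 0 → 0 ≤ ord_p Reg_p + ord_p ∏c_ℓ` from the image curve**: at an A2 pair
`(W, p)` with a degree-`p` `ℚ`-isogeny `φ : W → W'` onto a globally minimal `W'` whose Tamagawa indices satisfy
`p^{c'+1} ∤ [W'(ℚ) : W'(ℚ) ∩ W'⁰(ℚ_ℓ)]` for all `ℓ` (`1 ≤ c'`), and `2c' ≤ ord_p ∏c_ℓ(W)`, EVERY canonical datum of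
`W` satisfies the floor. `W'` is again a leaf curve (`RankOne.Leaf.of_isIsogenous`), so `ord_p #Ẽ'(𝔽_p) = 1 ≤ c'`;
`rank W = 1` by GZK. [cite: MazurTate1983Biext, §3.3, §3.4 (3.4.3), (4.1.1)] [cite: MazurSteinTate2006, Thm. 1.3] -/
theorem regTamFloor_of_typeBRankOne_of_isogeny_of_image_index_le
    (hadjF : Literature.NumberTheory.EllipticCurves.canonicalPAdicHeight_isogeny_adjoint)
    (hMT : mazur_tate_sigma_exists_odd) (hGZK : rank_eq_analyticRank_of_analyticRank_le_one)
    (hB : X1.TypeBRankOne W p) (φ : Isogeny W W') (hdeg : φ.degree = p)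
    {f : W.toAffine.Point →+ W'.toAffine.Point}
    (hf : ∀ P : W.toAffine.Point, W'.toGeomPoints (f P) = φ (W.toGeomPoints P)) {c' : ℕ} (hc : 1 ≤ c')
    (hidx' : ∀ (ℓ : ℕ) [Fact ℓ.Prime], ¬ p ^ (c' + 1) ∣ (W'.nonsingularReductionSubgroupAt ℓ).index)
    (hTam : 2 * c' ≤ padicValNat p W.tamagawaProduct) :
    ∀ Dh : PAdicHeightData W p, Dh.IsCanonical → padicRegulator Dh ≠ 0 →
      0 ≤ (padicRegulator Dh).valuation + (padicValNat p W.tamagawaProduct : ℤ) := by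
  intro Dh hDh hR
  have hX := isClassX1_of_classX1 hB.1
  have hL : X1.RankOne.Leaf W p := X1.RankOne.leaf_of_classX1 hB.1 hB.2.1
  -- the isogenous member is again a leaf curve: good ordinary (anomalous) reduction at `p`
  have hL' : X1.RankOne.Leaf W' p := hL.of_isIsogenous ⟨φ⟩
  have hX' := isClassX1_of_classX1 hL'.1
  have hp3 : 3 ≤ p := by
    have h2 := hB.1.1
    have hp2 := hX.two_ne
    omega
  have hN' : padicValNat p (W'.reductionPointCount p) ≤ c' := by
    rw [hL'.padicValNat_reductionPointCount_eq_one]; exact hc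
  have h := valuation_padicRegulator_ge_of_isogeny_of_image_index_le hadjF hMT hp3 hX.hasGoodReductionAtPrime
    hX.not_dvd_frobeniusTrace hX'.hasGoodReductionAtPrime hX'.not_dvd_frobeniusTrace hN' hidx' φ hdeg hf hDh hR
  obtain ⟨hrk, -⟩ := hGZK W hB.2.1.le
  have hr1 : (W.mordellWeilRank : ℤ) = 1 := by exact_mod_cast hrk.trans hB.2.1
  rw [hr1, mul_one] at h
  have hT : 2 * (c' : ℤ) ≤ (padicValNat p W.tamagawaProduct : ℤ) := by exact_mod_cast hTam
  linarith

/-! ## §3. T-λ3 on the image-index locus of corner A2 -/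

/-- **T-λ3 from the image curve's indices: `λ_an ≠ 1`** at every A2 pair `(W, p)` with a degree-`p` `ℚ`-isogeny
`φ : W → W'` onto a globally minimal `W'` with `p^{c'+1} ∤` the Tamagawa indices of `W'` (`1 ≤ c'`) and
`2c' ≤ ord_p ∏c_ℓ(W)` (census: 34 of the 42 A2 class-pairs with an index of `W` divisible by `p²`, all at
`c' = 1`). Published inputs BY NAME: W16, Perrin-Riou–Schneider (BMS 1.7), GV Thm. 1.3, Greenberg Prop. 5.10,
Mazur–Tate σ (odd `p`), modularity, GZK, MT83 (3.4.3); NO structural hypothesis on `φ`, NO height value inspected.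
[cite: BalakrishnanMullerStein2015, Thm. 1.7] [cite: GreenbergVatsal2000, Thm. (1.3)]
[cite: GreenbergLNM1716, Prop. 5.10 (PDF p. 147)] [cite: Wuthrich2014, Thm. 16 (p. 393)]
[cite: MazurTate1983Biext, §3.3 and §3.4 (3.4.3)] -/
theorem not_analyticLambdaEq_one_of_typeBRankOne_of_isogeny_of_image_index_le
    (hW16 : Wuthrich2014.charIdeal_dvd_padicLFunction) (hS : Schneider1985_order_charGenerator_odd)
    (hGV : GreenbergVatsal2000.thm13_charIdeal_eq_of_gvPar)
    (h510 : prop510_isTorsion_hasUnitContent_of_gvPar) (hMT : mazur_tate_sigma_exists_odd)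
    (hmodP : nonempty_modularParametrizationData) (hGZK : rank_eq_analyticRank_of_analyticRank_le_one)
    (hadjF : Literature.NumberTheory.EllipticCurves.canonicalPAdicHeight_isogeny_adjoint)
    (hB : X1.TypeBRankOne W p) (φ : Isogeny W W') (hdeg : φ.degree = p)
    {f : W.toAffine.Point →+ W'.toAffine.Point}
    (hf : ∀ P : W.toAffine.Point, W'.toGeomPoints (f P) = φ (W.toGeomPoints P)) {c' : ℕ} (hc : 1 ≤ c')
    (hidx' : ∀ (ℓ : ℕ) [Fact ℓ.Prime], ¬ p ^ (c' + 1) ∣ (W'.nonsingularReductionSubgroupAt ℓ).index)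
    (hTam : 2 * c' ≤ padicValNat p W.tamagawaProduct) : ¬ AnalyticLambdaEq W p 1 :=
  DegenerateLocusA2RegulatorFloorPub.not_analyticLambdaEq_one_of_typeBRankOne_of_regTamFloor hW16 hS hGV
    h510 hMT hmodP hGZK hB
    (regTamFloor_of_typeBRankOne_of_isogeny_of_image_index_le hadjF hMT hGZK hB φ hdeg hf hc hidx' hTam)

/-- **T-λ3, counted form, from the image curve's indices: every certified `λ_an = n` at such an A2 pair has
`n ≥ 3`** (λ-parity on rank one excludes `λ_an = 2`). [cite: GreenbergVatsal2000, Thm. (1.3)]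
[cite: MazurTateTeitelbaum1986Invent, §I.17–I.18] [cite: MazurTate1983Biext, §3.4 (3.4.3)]
[cite: BalakrishnanMullerStein2015, Thm. 1.7] -/
theorem three_le_of_analyticLambdaEq_of_typeBRankOne_of_isogeny_of_image_index_le
    (hW16 : Wuthrich2014.charIdeal_dvd_padicLFunction) (hS : Schneider1985_order_charGenerator_odd)
    (hGV : GreenbergVatsal2000.thm13_charIdeal_eq_of_gvPar)
    (h510 : prop510_isTorsion_hasUnitContent_of_gvPar) (hMT : mazur_tate_sigma_exists_odd)
    (hmodP : nonempty_modularParametrizationData) (hGZK : rank_eq_analyticRank_of_analyticRank_le_one)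
    (hadjF : Literature.NumberTheory.EllipticCurves.canonicalPAdicHeight_isogeny_adjoint)
    (hB : X1.TypeBRankOne W p) (φ : Isogeny W W') (hdeg : φ.degree = p)
    {f : W.toAffine.Point →+ W'.toAffine.Point}
    (hf : ∀ P : W.toAffine.Point, W'.toGeomPoints (f P) = φ (W.toGeomPoints P)) {c' : ℕ} (hc : 1 ≤ c')
    (hidx' : ∀ (ℓ : ℕ) [Fact ℓ.Prime], ¬ p ^ (c' + 1) ∣ (W'.nonsingularReductionSubgroupAt ℓ).index)
    (hTam : 2 * c' ≤ padicValNat p W.tamagawaProduct) {n : ℕ} (hn : AnalyticLambdaEq W p n) : 3 ≤ n :=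
  DegenerateLocusA2RegulatorFloorPub.three_le_of_analyticLambdaEq_of_typeBRankOne_of_regTamFloor hW16 hS hGV
    h510 hMT hmodP hGZK hB
    (regTamFloor_of_typeBRankOne_of_isogeny_of_image_index_le hadjF hMT hGZK hB φ hdeg hf hc hidx' hTam) hn

end Summit.BirchSwinnertonDyer.BirchSwinnertonDyer.Theorems.DegenerateLocusA2HeightIntegralityImage

end
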